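import Mathlib
import Summits.NavierStokesRegularity.NavierStokesRegularity.Theorems.TypeIQuarterGateScarEnvelopeTypeISatelliteTowerGalleryNormalForm

/-!
# Isolation radius / Cantor–Bendixson census of the scar set (crux idea `isolation-radius`,
# ns-idea-17 g2, lens «control», crux `TypeIQuarterGate.ScarEnvelopeTypeI` = item 23843)

HONEST FRAMING.  A NORMAL FORM / CENSUS on the H3 wall (23843), movement 0.  Nothing open is
proved: 23843, the leaf exclusion (E1) `∀ M, ¬ OneScarLeaf M`, the residual below, the route
`TypeIQuarterGate` and Navier–Stokes regularity are all OPEN.  NS regularity is NOT proved.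

THE LEVER.  The scar set `Σ(V) = {y | ¬ RegPt V y}` of an A–B object and its ISOLATION RADIUS at a
scar (distance to the nearest other scar) are covariant under the full similarity group of the
class: translations + parabolic zooms (`ABTower.galleryMap`).  Consequence (kernel, below):

* `oneScarLeaf_of_isolatedScar` — an ISOLATED scar `y` of ANY A–B object of rate `M` (regular on
  the punctured ball `B(y, ε) ∖ {y}`) yields, after recentring at `y` and zooming by `ε`, a
  `OneScarLeaf M` (the route's first exclusion (E1) is exactly «root = only scar in the unit ball»).
* `noOneScarLeaf_iff_scarsAccumulate` — hence (E1) is EQUIVALENT to: every A–B object's scar set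
  has NO isolated point (is perfect-or-empty; «Cantor–Bendixson stable»).
* `scarEnvelopeTypeI_of_noOneScarLeaf_noPerfectSelfDescending` — NEW KERNEL REDUCTION of 23843 by
  name: (E1) ∧ «no PERFECT self-descending node» ⇒ `ScarEnvelopeTypeI`, where the residual is the
  tree's root-recurrent exact equi-rated self-descending node (`ABTower.envelopedLeaf_or_selfDescending`,
  p653175) RESTRICTED to objects all of whose scars are accumulation points of scars, with gallery
  minimality transported to the node's OWN gallery (`IsGalleryLimit.trans`).
* `regPt_of_weakL3_of_noOneScarLeaf` — with the Choe–Wolf–Yang / Seregin / Barker SCAR-COUNTING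
  theorem typed as a hypothesis `WeakL3ScarCounting` (paper:choe2019 = Math. Ann. 377 (2020);
  arXiv:1906.06707 Thm 1.2; arXiv:2111.14776), (E1) alone forces: an A–B object obeying a local
  `L^∞_t L^{3,∞}_x` bound near `(0,y)` is regular at `y`; i.e. the residual enemy's local weak-L³
  norm is UNBOUNDED near every scar (`not_weakL3BoundNear_of_scar`) — sup-norm Type I alone only
  gives growth `≲ (−t)^{-1/2}` of that norm, so this is a genuine exclusion of a sub-face.

SAME-WALL: H3 (23843 kernel exclusions); the (E1) side is W7/H2 via
`envelopedExclusions_iff_typeILiouvilleAB`.  The DISCRETE-scar DSS face (`dss_selfDescendingNode`,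
every numerically visible λ-DSS profile) has isolated scars, so under this census it is (E1)'s
witness class, not the residual's; the residual enemy carries a perfect (uncountable, 𝓗¹-null by
CKN) scar continuum — squarely the regime of the Scheffer nearly-one-dimensional NSI constructions
(`Literature.Barriers.NavierStokesRegularity.NavierStokesInequalityCantor*`): no suitability-only
argument can close it.
-/

noncomputable section

-- the summit-side namespace repeats a component by design (single-conjunct summit, D-0017)
set_option linter.dupNamespace false

open MeasureTheory Set Metric Filter Topology
open scoped ENNReal

namespace Summit.NavierStokesRegularity.NavierStokesRegularity.Cruxes.ScarEnvelopeTypeI.ZoomDictionary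

namespace Isolation

open Literature.Analysis.FluidPDE

variable {U : ℝ → (EuclideanSpace ℝ (Fin 3)) → (EuclideanSpace ℝ (Fin 3))}
  {P : ℝ → (EuclideanSpace ℝ (Fin 3)) → ℝ}
  {H : ℝ → (EuclideanSpace ℝ (Fin 3)) → (EuclideanSpace ℝ (Fin 3)) →L[ℝ] (EuclideanSpace ℝ (Fin 3))}
  {M : ℝ}

/-! ### 1. Transport of regular points into a recentred zoom -/

/-- Regularity at `x + l • w` of `U` gives regularity at `w` of the recentred zoom `zoom U x 0 l`
(the converse direction of the tree's `regPt_of_regPt_zoom_zero`, at an arbitrary point). -/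
theorem regPt_zoom_of_regPt {x w : EuclideanSpace ℝ (Fin 3)} {l : ℝ} (hl : 0 < l)
    (h : RegPt U (x + l • w)) : RegPt (zoom U x 0 l) w := by
  obtain ⟨r, hr, K, hK⟩ := h
  refine ⟨r / l, div_pos hr hl, l * K, ?_⟩
  have hpre : stAffine (l ^ 2) l 0 x ⁻¹' parabolicCylinder r ((0 : ℝ), x + l • w) =
      parabolicCylinder (r / l) ((0 : ℝ), w) := by
    have h1 := LocalTypeIScaling.stAffine_preimage_parabolicCylinder hl (0 : ℝ) x (r / l)
      ((0 : ℝ), w)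
    have e : stAffine (l ^ 2) l 0 x ((0 : ℝ), w) = ((0 : ℝ), x + l • w) := by
      rw [stAffine_apply, mul_zero, add_zero]
    rwa [e, mul_div_cancel₀ _ hl.ne'] at h1
  have h2 := ae_restrict_preimage_stAffine (pow_pos hl 2) hl (0 : ℝ) x hK
  rw [hpre] at h2
  filter_upwards [h2] with z hz
  obtain ⟨s, y⟩ := z
  have hz' : ‖U (0 + l ^ 2 * s) (x + l • y)‖ ≤ K := hz
  show ‖l • U (0 + l ^ 2 * s) (x + l • y)‖ ≤ l * K
  rw [norm_smul, Real.norm_of_nonneg hl.le]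
  exact mul_le_mul_of_nonneg_left hz' hl.le

/-! ### 2. Isolated scars are one-scar leaves -/

/-- **Every scar of `U` is an accumulation point of scars** (the scar set has no isolated point;
with closedness: it is perfect or empty). -/
def ScarsAccumulate (U : ℝ → (EuclideanSpace ℝ (Fin 3)) → (EuclideanSpace ℝ (Fin 3))) : Prop :=
  ∀ y : EuclideanSpace ℝ (Fin 3), ¬ RegPt U y → ∀ ε : ℝ, 0 < ε →
    ∃ y' : EuclideanSpace ℝ (Fin 3), y' ≠ y ∧ dist y' y < ε ∧ ¬ RegPt U y'

/-- ★ **An isolated scar of ANY A–B object is a one-scar leaf of the same rate**: recentre at the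
scar and zoom by the isolation radius (`ABTower.galleryMap` keeps the class and the rate). -/
theorem oneScarLeaf_of_isolatedScar (h : ABTower M U P H) {y : EuclideanSpace ℝ (Fin 3)}
    (hy : ¬ RegPt U y) {ε : ℝ} (hε : 0 < ε)
    (hiso : ∀ y' : EuclideanSpace ℝ (Fin 3), y' ≠ y → dist y' y < ε → RegPt U y') :
    OneScarLeaf M := by
  refine ⟨zoom U y 0 ε, zoomP P y 0 ε, ε ^ 2 • stPull (ε ^ 2) ε 0 y H, h.galleryMap y hε,
    fun hr => hy (regPt_of_regPt_zoom_zero hε hr), fun w hw0 hw1 => regPt_zoom_of_regPt hε ?_⟩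
  refine hiso _ (fun heq => hw0 ?_) ?_
  · have h1 : ε • w = 0 := by
      rw [← add_sub_cancel_left y (ε • w), heq, sub_self]
    rcases smul_eq_zero.1 h1 with h2 | h2
    · exact absurd h2 hε.ne'
    · exact h2
  · rw [dist_eq_norm, add_sub_cancel_left, norm_smul, Real.norm_of_nonneg hε.le]
    calc ε * ‖w‖ < ε * 1 := mul_lt_mul_of_pos_left hw1 hε
      _ = ε := mul_one ε

/-- Under the route's leaf exclusion (E1), every A–B object's scars accumulate. -/
theorem scarsAccumulate_of_noOneScarLeaf (hE : ∀ M : ℝ, ¬ OneScarLeaf M) (h : ABTower M U P H) :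
    ScarsAccumulate U := by
  intro y hy ε hε
  by_contra hne
  push Not at hne
  exact hE M (oneScarLeaf_of_isolatedScar h hy hε hne)

/-- ★ **(E1) ⟺ Cantor–Bendixson stability of all A–B scar sets**: no one-scar leaf at any rate iff
every A–B object's scar set has no isolated point. -/
theorem noOneScarLeaf_iff_scarsAccumulate :
    (∀ M : ℝ, ¬ OneScarLeaf M) ↔
    ∀ (M : ℝ) (U : ℝ → (EuclideanSpace ℝ (Fin 3)) → (EuclideanSpace ℝ (Fin 3)))
      (P : ℝ → (EuclideanSpace ℝ (Fin 3)) → ℝ)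
      (H : ℝ → (EuclideanSpace ℝ (Fin 3)) → (EuclideanSpace ℝ (Fin 3)) →L[ℝ] (EuclideanSpace ℝ (Fin 3))),
      ABTower M U P H → ScarsAccumulate U := by
  constructor
  · intro hE M U P H h
    exact scarsAccumulate_of_noOneScarLeaf hE h
  · rintro h M ⟨U, P, H, hAB, h0, hreg⟩
    obtain ⟨y', hy', hd, hs⟩ := h M U P H hAB 0 h0 1 one_pos
    exact hs (hreg y' hy' (by simpa using hd))

/-! ### 3. The new kernel reduction: (E1) ∧ «no PERFECT self-descending node» ⇒ 23843 -/

/-- **The residual, restricted to perfect scar sets.**  A PERFECT SELF-DESCENDING NODE of rate `M`: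
a rooted, non-tame, self-descending node `n` (the tree's enemy of `scarEnvelopeTypeI_of_noEnvelopedLeaf_noSelfDescending`)
which is moreover root-recurrent (`IsRootOmegaLimit n.U n.U`), all of whose scars ACCUMULATE, and
which is an exact globally equi-rated gallery minimiser IN ITS OWN GALLERY (class `ABTower m⋆`,
every scar exactly `m⋆`-rated, `m⋆ ≤` the tight rate of every scar of every rate-`M` gallery limit
of `n.U`).  The residual exclusion says there is none. -/
def NoPerfectSelfDescendingNode : Prop :=
  ∀ (M : ℝ) (n : TNode), RootObj M n → ¬ TameRoot n → RootDescends n n →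
    IsRootOmegaLimit n.U n.U → ScarsAccumulate n.U →
    (∃ mstar : ℝ, ABTower mstar n.U n.P n.H ∧
      (∀ y : EuclideanSpace ℝ (Fin 3), ¬ RegPt n.U y → tightRate n.U y = mstar) ∧
      ∀ (W₂ : ℝ → (EuclideanSpace ℝ (Fin 3)) → (EuclideanSpace ℝ (Fin 3)))
        (P₂ : ℝ → (EuclideanSpace ℝ (Fin 3)) → ℝ)
        (H₂ : ℝ → (EuclideanSpace ℝ (Fin 3)) → (EuclideanSpace ℝ (Fin 3)) →L[ℝ] (EuclideanSpace ℝ (Fin 3)))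
        (y₂ : EuclideanSpace ℝ (Fin 3)),
        ABTower M W₂ P₂ H₂ → IsGalleryLimit n.U W₂ → ¬ RegPt W₂ y₂ → mstar ≤ tightRate W₂ y₂) →
    False

/-- ★★ **NEW KERNEL REDUCTION of 23843**: the leaf exclusion (E1) `∀ M, ¬ OneScarLeaf M` and the
exclusion of PERFECT self-descending nodes imply `ScarEnvelopeTypeI`.  (E1) does double duty: it
kills the enveloped-leaf branch of the tree's normal form AND makes the self-descending branch's
scar set perfect (`scarsAccumulate_of_noOneScarLeaf`). -/
theorem scarEnvelopeTypeI_of_noOneScarLeaf_noPerfectSelfDescending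
    (hE : ∀ M : ℝ, ¬ OneScarLeaf M) (hS : NoPerfectSelfDescendingNode) :
    Summit.NavierStokesRegularity.NavierStokesRegularity.Theses.TypeIQuarterGate.ScarEnvelopeTypeI := by
  by_contra h
  obtain ⟨M, U, P, H, e, hAB, -, h0, -, -⟩ := exists_abTower_of_not_scarEnvelopeTypeI h
  rcases hAB.envelopedLeaf_or_selfDescending h0 with
    ⟨A, hA⟩ | ⟨n, hn, ht, hd, hg, -, hω, m, hm, -, hsc, hmin⟩
  · exact hE M hA.oneScarLeaf
  · have hUmeas : ∀ R : ℝ, 0 < R → AEStronglyMeasurable (Function.uncurry U)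
        (volume.restrict (parabolicCylinder R (0 : ℝ × (EuclideanSpace ℝ (Fin 3))))) :=
      fun R hR => hAB.aestronglyMeasurable_uncurry hR
    have hAn : ABTower M n.U n.P n.H := hn.1
    exact hS M n hn ht hd hω (scarsAccumulate_of_noOneScarLeaf hE hAn)
      ⟨m, hm, hsc, fun W₂ P₂ H₂ y₂ h₂ hg₂ hy₂ => hmin W₂ P₂ H₂ y₂ h₂ (hg.trans hUmeas hg₂) hy₂⟩

/-- Census form: if 23843 fails then EITHER a one-scar leaf exists (⊇ every A–B object with an
isolated scar, in particular every discrete-scar DSS profile) OR a perfect self-descending node. -/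
theorem oneScarLeaf_or_perfectSelfDescending_of_not_scarEnvelopeTypeI
    (h : ¬ Summit.NavierStokesRegularity.NavierStokesRegularity.Theses.TypeIQuarterGate.ScarEnvelopeTypeI) :
    (∃ M : ℝ, OneScarLeaf M) ∨ ¬ NoPerfectSelfDescendingNode := by
  by_contra hc
  push Not at hc
  exact h (scarEnvelopeTypeI_of_noOneScarLeaf_noPerfectSelfDescending hc.1 hc.2)

/-! ### 4. The weak-L³ sub-face is (E1)'s: Choe–Wolf–Yang scar counting as a typed hypothesis -/

/-- A local-in-time-uniform **weak-L³ bound** of `W` near the final-time point `(0, y)`: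
`sup_{t ∈ (−R², 0)} sup_{α > 0} α³ · |{x ∈ B_R(y) : α < ‖W t x‖}| ≤ K` (distribution-function form
of `‖W‖_{L^∞(−R²,0; L^{3,∞}(B_R(y)))}³ ≤ K`; the set lies in a ball, so the measure is finite and
`toReal` carries no junk). -/
def WeakL3BoundNear (W : ℝ → (EuclideanSpace ℝ (Fin 3)) → (EuclideanSpace ℝ (Fin 3)))
    (y : EuclideanSpace ℝ (Fin 3)) (R K : ℝ) : Prop :=
  ∀ t ∈ Ioo (-(R ^ 2)) (0 : ℝ), ∀ α : ℝ, 0 < α →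
    α ^ 3 * (volume {x : EuclideanSpace ℝ (Fin 3) | x ∈ ball y R ∧ α < ‖W t x‖}).toReal ≤ K

/-- **SCAR COUNTING UNDER A WEAK-L³ BOUND** — the theorem of Choe–Wolf–Yang (Math. Ann. 377 (2020),
paper:choe2019), in Seregin's local form (arXiv:1906.06707, Thm 1.2 / Prop. 1.3) and Barker's
quantitative form (arXiv:2111.14776: `O(M^20)` singular points), READ ON THE A–B CLASS and typed as
a hypothesis (an unformalised published result, never asserted): a weak-L³ bound near `(0,y)` leaves
only finitely many scars in the closed half-ball. -/
def WeakL3ScarCounting : Prop :=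
  ∀ (M : ℝ) (U : ℝ → (EuclideanSpace ℝ (Fin 3)) → (EuclideanSpace ℝ (Fin 3)))
    (P : ℝ → (EuclideanSpace ℝ (Fin 3)) → ℝ)
    (H : ℝ → (EuclideanSpace ℝ (Fin 3)) → (EuclideanSpace ℝ (Fin 3)) →L[ℝ] (EuclideanSpace ℝ (Fin 3))),
    ABTower M U P H → ∀ (y : EuclideanSpace ℝ (Fin 3)) (R K : ℝ), 0 < R → WeakL3BoundNear U y R K →
      {y' : EuclideanSpace ℝ (Fin 3) | dist y' y ≤ R / 2 ∧ ¬ RegPt U y'}.Finite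

/-- ★ **(E1) + scar counting ⇒ the weak-L³ sub-face is empty**: under the leaf exclusion, an A–B
object obeying a local weak-L³ bound near `(0, y)` is REGULAR at `y` (finitely many scars near `y`
would make one of them isolated, i.e. a one-scar leaf). -/
theorem regPt_of_weakL3_of_noOneScarLeaf (hE : ∀ M : ℝ, ¬ OneScarLeaf M) (hC : WeakL3ScarCounting)
    (h : ABTower M U P H) {y : EuclideanSpace ℝ (Fin 3)} {R K : ℝ} (hR : 0 < R)
    (hB : WeakL3BoundNear U y R K) : RegPt U y := by
  by_contra hy
  have hacc := scarsAccumulate_of_noOneScarLeaf hE h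
  have hfin : ({y' : EuclideanSpace ℝ (Fin 3) | dist y' y ≤ R / 2 ∧ ¬ RegPt U y'} \ {y}).Finite :=
    (hC M U P H h y R K hR hB).subset fun _ hz => hz.1
  obtain ⟨ε, hε, hball⟩ := Metric.isOpen_iff.1 hfin.isClosed.isOpen_compl y (by simp)
  obtain ⟨y', hne, hd, hs⟩ := hacc y hy (min ε (R / 2)) (lt_min hε (half_pos hR))
  have hmem : y' ∈ ball y ε := by
    rw [mem_ball]
    exact lt_of_lt_of_le hd (min_le_left _ _)
  exact hball hmem ⟨⟨(lt_of_lt_of_le hd (min_le_right _ _)).le, hs⟩, hne⟩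

/-- ★ Contrapositive normal form: under (E1) and scar counting, **the local weak-L³ norm of an A–B
object is unbounded near EVERY scar, on EVERY ball** (sup-norm Type I alone bounds
`‖W(t)‖_{L^{3,∞}(B_R)}` only by `m⋆ |B_R|^{1/3} (−t)^{-1/2}`). -/
theorem not_weakL3BoundNear_of_scar (hE : ∀ M : ℝ, ¬ OneScarLeaf M) (hC : WeakL3ScarCounting)
    (h : ABTower M U P H) {y : EuclideanSpace ℝ (Fin 3)} (hy : ¬ RegPt U y) {R : ℝ} (hR : 0 < R)
    (K : ℝ) : ¬ WeakL3BoundNear U y R K :=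
  fun hB => hy (regPt_of_weakL3_of_noOneScarLeaf hE hC h hR hB)

end Isolation

end Summit.NavierStokesRegularity.NavierStokesRegularity.Cruxes.ScarEnvelopeTypeI.ZoomDictionary
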